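import Summits.CriticalPhenomena.CardyFormulaZ2.Theorems.CardyComplexConeEdgePrecompactWallWinding
import Summits.CriticalPhenomena.CardyFormulaZ2.Theorems.CardyComplexConeEdgePrecompactWallPassage
import Summits.CriticalPhenomena.CardyFormulaZ2.Theorems.CardyComplexConeEdgePrecompactVertexRelation
import Literature.Probability.LatticeModels.FKFamilyObservable
import Literature.Probability.LatticeModels.LatticeDobrushinBox
import Literature.Probability.Percolation.RSW

/-!
# Evaluation of the corner observable at the free wall of the three-sided box
(line `qkz-strip-boundary-arm` of crux `CardyComplexCone.EdgePrecompact`, stmt-CriticalPhenomena-11387;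
necessity certificate "UniformInnerEnvelope ⇒ cube-root half-plane one-arm bound", piece N6,
registered sub-goal `threeSided_wallObs`)

Setting: the three-sided box `LatticeDobrushin.threeSided W H` (sites `[0, W] × [-1, H]`, wired on its
left column, top row and right column — the arc `A`; the bottom row `[0, W] × {-1}` is the free arc `B`),
its realisation `E = (threeSided W H).toDobrushin` at mesh `1`, admissible (`hE`), a wall abscissa
`0 < x < W`, and the two wall darts at the site `(x, 0)`: the east-going dart `q₃ = ((x, 0), 3)` of the
wall face `(x, -1)` and the south-going dart `q₂ = ((x, 0), 2)` of the wall face `(x - 1, -1)`, which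
ends at the (closed) wall edge `{(x, 0), (x, -1)}`. Write `V₃`, `V₂` for the events that `q₃`, resp.
`q₂`, is a dart of the medial exploration path (the cut orbit of the start corner up to the exit time)
and `P = P_{1/2}`.

**Theorem `threeSided_wallObs`.**
1. `cornerObs E 1 (x, 0) (faceAt (x, 0) 3) = P(V₃)`;
2. `cornerObs E 1 (x, 0) (faceAt (x, 0) 2) = e^{iπ/6} · P(V₂)`;
3. `P(V₂) ≤ P(V₃)`;
4. `P((x, 0) ↔ A inside [0, W] × [0, H]) ≤ P(V₃)`.

Proof. The integrand of `cornerObs` at a coded corner `q` is the orbit phase sum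
`∑_{j < N, orb j = q} exp (-(iπ/6) · turnCount j)` (`dartPhaseSum_eq_orbitSum`), with at most one term
(`card_filter_cornerOrbit_le_one`). (1) At `q₃` the term is `1`: the exploration arrives at every
free-wall dart with zero net turning (`threeSided_turnCount_wallDart`, piece N4); so the integrand is
the indicator of `V₃`. (2) If `orb j = q₂`, the wall edge below `(x, 0)` is closed (it touches `B`), so
the exploration crosses it with a left turn: `orb (j + 1) = q₃`, `turnCount (j + 1) = turnCount j + 1`,
and `j + 1 < N` because the face `(x, -1)` of `q₃` is inner; by N4 at `j + 1`, `turnCount j = -1` and the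
term is `e^{iπ/6}`. (3) The same successor step gives `V₂ ⊆ V₃`. (4) Almost every configuration consists
of lattice edges; an open path from `(x, 0)` to `A` inside `[0, W] × [0, H]` avoids the bottom row, so its
edges are open in the completed configuration `E.bcBondConfig ω`, and the planar passage lemma
`threeSided_wallDart_of_joined` (piece N3) puts `q₃` on the exploration.

References: H. Duminil-Copin, C. Hongler, P. Nolin, Comm. Pure Appl. Math. 64 (2011), §4, proof of
Lemma 12; S. Smirnov, Ann. of Math. 172 (2010), §2.2.
-/

namespace Summit.CriticalPhenomena.CardyFormulaZ2.Cruxes.EdgePrecompact.QkzStripBoundaryArm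

open MeasureTheory Filter Set Metric
open scoped Topology BigOperators Pointwise
open Literature.Probability.LatticeModels Literature.Probability.Percolation
open Literature.Probability.RandomPlanarGeometry (DobrushinDomain)
open Summit.CriticalPhenomena.CardyFormulaZ2.Theses.CardyComplexCone

noncomputable section

/-! ## Two bookkeeping lemmas -/

/-- A filtered range with at most one element, on which the summand is constant `= c`, sums to the
indicator (value `c`) of the event `V` that the filter is inhabited. -/
private theorem sum_filter_eq_indicator_N6 {N : ℕ} {P : ℕ → Prop} {hdec : DecidablePred P} {f : ℕ → ℂ} {c : ℂ}
    {V : Set (BondConfig (Site 2))} {ω : BondConfig (Site 2)} (hV : ω ∈ V ↔ ∃ j < N, P j)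
    (hcard : ((Finset.range N).filter P).card ≤ 1) (hf : ∀ j < N, P j → f j = c) :
    ∑ j ∈ (Finset.range N).filter P, f j = V.indicator (fun _ => c) ω := by
  by_cases h : ∃ j < N, P j
  · obtain ⟨k, hkN, hk⟩ := id h
    have hkS : k ∈ (Finset.range N).filter P := Finset.mem_filter.2 ⟨Finset.mem_range.2 hkN, hk⟩
    have hS : (Finset.range N).filter P = {k} :=
      Finset.eq_singleton_iff_unique_mem.2 ⟨hkS, fun j hj => Finset.card_le_one.1 hcard j hj k hkS⟩
    rw [hS, Finset.sum_singleton, hf k hkN hk, Set.indicator_of_mem (hV.2 h)]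
  · rw [Set.indicator_of_notMem (fun hω => h (hV.1 hω))]
    refine Finset.sum_eq_zero fun j hj => ?_
    rw [Finset.mem_filter, Finset.mem_range] at hj
    exact absurd ⟨j, hj.1, hj.2⟩ h

/-- An event whose indicator (times a nonzero constant) is a measurable function is measurable. -/
private theorem measurableSet_of_indicator_N6 {V : Set (BondConfig (Site 2))} {F : BondConfig (Site 2) → ℂ}
    {c : ℂ} (hF : Measurable F) (hc : c ≠ 0) (h : ∀ ω, F ω = V.indicator (fun _ => c) ω) :
    MeasurableSet V := by
  have hV : V = F ⁻¹' {0}ᶜ := by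
    ext ω
    rw [Set.mem_preimage, Set.mem_compl_iff, Set.mem_singleton_iff, h ω]
    by_cases hω : ω ∈ V
    · rw [Set.indicator_of_mem hω]
      exact ⟨fun _ => hc, fun _ => hω⟩
    · rw [Set.indicator_of_notMem hω]
      exact ⟨fun h' => absurd h' hω, fun h' => absurd rfl h'⟩
  rw [hV]
  exact hF (measurableSet_singleton 0).compl

/-! ## The three-sided box: the two wall darts at `(x, 0)` -/

section ThreeSided

open LatticeDobrushin

variable {W H : ℕ} (hE : (threeSided W H).toDobrushin.IsZdAdmissible) (ω : BondConfig (Site 2))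

/-- **The successor of the south-going wall dart.** If `q₂ = ((x, 0), 2)`, `0 < x < W`, is the `j`-th
dart of the exploration (`j` before the exit time), then the wall edge `{(x, 0), (x, -1)}` it arrives at
is closed in the completed configuration (it touches `B`), so the exploration crosses it with a left
turn: the `(j + 1)`-st dart is `q₃ = ((x, 0), 3)`, still before the exit time (its face `(x, -1)` is
inner), and `turnCount j = -1` (by the wall winding lemma N4 at `j + 1`). -/
private theorem succ_of_orbit_eq_q₂_N6 {x : ℕ} (hx1 : 1 ≤ x) (hxW : x + 1 ≤ W) {j : ℕ}
    (hj : j < DiscreteDobrushin.exitTime hE ω)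
    (horb : cornerOrbit ((threeSided W H).toDobrushin.bcBondConfig ω) (DiscreteDobrushin.startCorner hE) j =
      (![(x : ℤ), 0], 2)) :
    j + 1 < DiscreteDobrushin.exitTime hE ω ∧
      cornerOrbit ((threeSided W H).toDobrushin.bcBondConfig ω) (DiscreteDobrushin.startCorner hE) (j + 1) =
        (![(x : ℤ), 0], 3) ∧
      turnCount ((threeSided W H).toDobrushin.bcBondConfig ω) (DiscreteDobrushin.startCorner hE) j = -1 := by
  set q : Site 2 × Fin 4 := (![(x : ℤ), 0], 2) with hqdef
  -- the wall edge below `(x, 0)` is closed, so the successor of `q` is the wall dart `q₃`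
  have hxB : (![(x : ℤ), -1] : Site 2) ∈ (threeSided W H).toDobrushin.zdArcB := by
    rw [zdArcB_threeSided, Set.mem_setOf_eq]
    simp; omega
  have htgt : q.1 + cornerUnit (q.2 + 1) = ![(x : ℤ), -1] := by
    funext i; fin_cases i <;> simp [hqdef, cornerUnit]
  have hclosed : cTgt q ∉ (threeSided W H).toDobrushin.bcBondConfig ω :=
    DiscreteDobrushin.not_mem_bcBondConfig_of_mem_zdArcB hE (Sym2.mem_mk_right _ _) (htgt ▸ hxB)
  have hnext : nextCorner ((threeSided W H).toDobrushin.bcBondConfig ω) q = (![(x : ℤ), 0], 3) := by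
    rw [nextCorner_of_not_mem hclosed]; rfl
  have horb1 : cornerOrbit ((threeSided W H).toDobrushin.bcBondConfig ω) (DiscreteDobrushin.startCorner hE) (j + 1) =
      (![(x : ℤ), 0], 3) := by
    rw [cornerOrbit_succ, horb, hnext]
  -- the face `(x, -1)` of `q₃` is inner, so `j + 1` is before the exit time
  have hfd : (threeSided W H).toDobrushin.IsInnerFace (cFace ((![(x : ℤ), 0], 3) : Site 2 × Fin 4)) := by
    rw [isInnerFace_threeSided_iff]
    simp [cFace, faceAt, cornerOff]; omega
  have hj1 : j + 1 < DiscreteDobrushin.exitTime hE ω := by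
    by_contra h
    have heq : j + 1 = DiscreteDobrushin.exitTime hE ω := by omega
    have := DiscreteDobrushin.not_isInnerFace_exitTime hE ω
    rw [← heq, horb1] at this
    exact this hfd
  -- the wall winding lemma at `j + 1` and the left turn at `j`
  have h0 := threeSided_turnCount_wallDart W H hE ω x (j + 1) hx1 hxW hj1 horb1
  have hsign : turnSign ((threeSided W H).toDobrushin.bcBondConfig ω)
      (cornerOrbit ((threeSided W H).toDobrushin.bcBondConfig ω) (DiscreteDobrushin.startCorner hE) j) = 1 := by
    rw [horb]; exact turnSign_of_not_mem hclosed
  rw [turnCount_succ, hsign] at h0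
  exact ⟨hj1, horb1, by omega⟩

/-- **The integrand of `cornerObs` at the east-going wall dart `q₃` is the indicator of `V₃`**: the
orbit phase sum at `q₃` has at most one term, equal to `exp 0 = 1` by the wall winding lemma N4. -/
private theorem dartPhaseSum_q₃_N6 {x : ℕ} (hx1 : 1 ≤ x) (hxW : x + 1 ≤ W) :
    dartPhaseSum (medialExploration (threeSided W H).toDobrushin ω) 1 (1 / 3) (![(x : ℤ), 0], faceAt ![(x : ℤ), 0] 3) =
      {ω : BondConfig (Site 2) | ∃ k < DiscreteDobrushin.exitTime hE ω,
          cornerOrbit ((threeSided W H).toDobrushin.bcBondConfig ω) (DiscreteDobrushin.startCorner hE) k =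
            (![(x : ℤ), 0], 3)}.indicator (fun _ => (1 : ℂ)) ω := by
  have key := dartPhaseSum_eq_orbitSum hE ω (![(x : ℤ), 0], 3)
  refine key.trans (sum_filter_eq_indicator_N6 Iff.rfl (card_filter_cornerOrbit_le_one hE ω _) fun j hj horb => ?_)
  rw [threeSided_turnCount_wallDart W H hE ω x j hx1 hxW hj horb]
  simp

/-- **The integrand of `cornerObs` at the south-going wall dart `q₂` is `e^{iπ/6}` times the indicator
of `V₂`**: the orbit phase sum at `q₂` has at most one term, equal to `exp (-(iπ/6) · (-1))` by
`succ_of_orbit_eq_q₂_N6`. -/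
private theorem dartPhaseSum_q₂_N6 {x : ℕ} (hx1 : 1 ≤ x) (hxW : x + 1 ≤ W) :
    dartPhaseSum (medialExploration (threeSided W H).toDobrushin ω) 1 (1 / 3) (![(x : ℤ), 0], faceAt ![(x : ℤ), 0] 2) =
      {ω : BondConfig (Site 2) | ∃ k < DiscreteDobrushin.exitTime hE ω,
          cornerOrbit ((threeSided W H).toDobrushin.bcBondConfig ω) (DiscreteDobrushin.startCorner hE) k =
            (![(x : ℤ), 0], 2)}.indicator (fun _ => Complex.exp (Real.pi / 6 * Complex.I)) ω := by
  have key := dartPhaseSum_eq_orbitSum hE ω (![(x : ℤ), 0], 2)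
  refine key.trans (sum_filter_eq_indicator_N6 Iff.rfl (card_filter_cornerOrbit_le_one hE ω _) fun j hj horb => ?_)
  rw [(succ_of_orbit_eq_q₂_N6 hE ω hx1 hxW hj horb).2.2]
  congr 1
  push_cast
  ring

/-- **`V₂ ⊆ V₃`**: if the south-going wall dart is explored, so is its successor, the east-going one. -/
private theorem V₂_subset_V₃_N6 {x : ℕ} (hx1 : 1 ≤ x) (hxW : x + 1 ≤ W) :
    {ω : BondConfig (Site 2) | ∃ k < DiscreteDobrushin.exitTime hE ω,
        cornerOrbit ((threeSided W H).toDobrushin.bcBondConfig ω) (DiscreteDobrushin.startCorner hE) k =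
          (![(x : ℤ), 0], 2)} ⊆
      {ω : BondConfig (Site 2) | ∃ k < DiscreteDobrushin.exitTime hE ω,
        cornerOrbit ((threeSided W H).toDobrushin.bcBondConfig ω) (DiscreteDobrushin.startCorner hE) k =
          (![(x : ℤ), 0], 3)} := by
  rintro ω ⟨k, hk, horb⟩
  have h := succ_of_orbit_eq_q₂_N6 hE ω hx1 hxW hk horb
  exact ⟨k + 1, h.1, h.2.1⟩

/-- **Open paths off the bottom row are open in the completed configuration.** For a configuration
of lattice edges, an open path inside `[0, W] × [0, H]` is a path of `E.bcBondConfig ω`-open edges (its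
edges are edges of the box with no endpoint on the bottom row `B`). -/
private theorem reachable_bc_of_openConnIn_N6 {ω : BondConfig (Site 2)} (hω : ω ⊆ (zdGraph 2).edgeSet)
    {u a : Site 2}
    (h : ω ∈ openConnIn {v : Site 2 | 0 ≤ v 0 ∧ v 0 ≤ (W : ℤ) ∧ 0 ≤ v 1 ∧ v 1 ≤ (H : ℤ)} u a) :
    (openGraph ((threeSided W H).toDobrushin.bcBondConfig ω)).Reachable u a := by
  obtain ⟨hu, ha, hreach⟩ := h
  set R : Set (Site 2) := {v : Site 2 | 0 ≤ v 0 ∧ v 0 ≤ (W : ℤ) ∧ 0 ≤ v 1 ∧ v 1 ≤ (H : ℤ)} with hR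
  have hS : ∀ v ∈ R, v ∈ (threeSided W H).S := by
    intro v hv
    rw [hR, Set.mem_setOf_eq] at hv
    rw [mem_threeSided_S]
    omega
  have hB : ∀ v ∈ R, v ∉ (threeSided W H).toDobrushin.zdArcB := by
    intro v hv hvB
    rw [hR, Set.mem_setOf_eq] at hv
    rw [zdArcB_threeSided, Set.mem_setOf_eq] at hvB
    omega
  let φ : ((openGraph ω).induce R) →g openGraph ((threeSided W H).toDobrushin.bcBondConfig ω) :=
    { toFun := Subtype.val
      map_rel' := fun {p q} hpq => by
        have hpq' : (openGraph ω).Adj p.1 q.1 := hpq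
        rw [openGraph_adj] at hpq' ⊢
        refine ⟨⟨?_, Or.inr ⟨hpq'.1, fun y hy => ?_⟩⟩, hpq'.2⟩
        · rw [LatticeDobrushin.mem_edgeSet_iff]
          exact ⟨hω hpq'.1, hS _ p.2, hS _ q.2⟩
        · rcases Sym2.mem_iff.1 hy with rfl | rfl
          exacts [hB _ p.2, hB _ q.2] }
  exact hreach.map φ

end ThreeSided

/-! ## The stub -/

/-- **Evaluation of the corner observable at the free wall of the three-sided box** (necessity
certificate, piece N6). In the three-sided box `threeSided W H` with admissible realisation `E` (mesh
`1`) and for a wall abscissa `0 < x < W`, with `V₃`, `V₂` the events that the east-going wall dart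
`((x, 0), 3)`, resp. the south-going wall dart `((x, 0), 2)`, is a dart of the medial exploration path
before the exit time: (1) `cornerObs E 1 (x, 0) (faceAt (x, 0) 3) = P(V₃)` (zero winding at the free
wall, N4); (2) `cornerObs E 1 (x, 0) (faceAt (x, 0) 2) = e^{iπ/6} P(V₂)` (the south-going dart is followed
by a forced left turn onto the wall); (3) `P(V₂) ≤ P(V₃)`; (4) `P((x, 0) ↔ A in [0, W] × [0, H]) ≤ P(V₃)`
(the planar passage lemma N3, for almost every configuration). DCHN 2011, proof of Lemma 12;
Smirnov 2010, §2.2. -/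
theorem threeSided_wallObs : ∀ (W H : ℕ) (hE : (LatticeDobrushin.threeSided W H).toDobrushin.IsZdAdmissible) (x : ℕ), 1 ≤ x → x + 1 ≤ W → cornerObs (LatticeDobrushin.threeSided W H).toDobrushin 1 ![(x : ℤ), 0] (faceAt ![(x : ℤ), 0] 3) = (((bondPercolation (zdGraph 2) half).real {ω : BondConfig (Site 2) | ∃ k < DiscreteDobrushin.exitTime hE ω, cornerOrbit ((LatticeDobrushin.threeSided W H).toDobrushin.bcBondConfig ω) (DiscreteDobrushin.startCorner hE) k = (![(x : ℤ), 0], 3)} : ℝ) : ℂ) ∧ cornerObs (LatticeDobrushin.threeSided W H).toDobrushin 1 ![(x : ℤ), 0] (faceAt ![(x : ℤ), 0] 2) = Complex.exp (Real.pi / 6 * Complex.I) * (((bondPercolation (zdGraph 2) half).real {ω : BondConfig (Site 2) | ∃ k < DiscreteDobrushin.exitTime hE ω, cornerOrbit ((LatticeDobrushin.threeSided W H).toDobrushin.bcBondConfig ω) (DiscreteDobrushin.startCorner hE) k = (![(x : ℤ), 0], 2)} : ℝ) : ℂ) ∧ (bondPercolation (zdGraph 2) half).real {ω : BondConfig (Site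 2) | ∃ k < DiscreteDobrushin.exitTime hE ω, cornerOrbit ((LatticeDobrushin.threeSided W H).toDobrushin.bcBondConfig ω) (DiscreteDobrushin.startCorner hE) k = (![(x : ℤ), 0], 2)} ≤ (bondPercolation (zdGraph 2) half).real {ω : BondConfig (Site 2) | ∃ k < DiscreteDobrushin.exitTime hE ω, cornerOrbit ((LatticeDobrushin.threeSided W H).toDobrushin.bcBondConfig ω) (DiscreteDobrushin.startCorner hE) k = (![(x : ℤ), 0], 3)} ∧ (bondPercolation (zdGraph 2) half).real {ω : BondConfig (Site 2) | ∃ a ∈ (LatticeDobrushin.threeSided W H).A, ω ∈ openConnIn {v : Site 2 | 0 ≤ v 0 ∧ v 0 ≤ (W : ℤ) ∧ 0 ≤ v 1 ∧ v 1 ≤ (H : ℤ)} ![(x : ℤ), 0] a} ≤ (bondPercolation (zdGraph 2) half).real {ω : BondConfig (Site 2) | ∃ k < DiscreteDobrushin.exitTime hE ω, cornerOrbit ((LatticeDobrushin.threeSided W H).toDobrushin.bcBondConfig ω) (DiscreteDobrushin.startCorner hE) k = (![(x : ℤ), 0], 3)} := by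
  intro W H hE x hx1 hxW
  set P := bondPercolation (zdGraph 2) half with hP
  set V₃ : Set (BondConfig (Site 2)) := {ω : BondConfig (Site 2) | ∃ k < DiscreteDobrushin.exitTime hE ω,
    cornerOrbit ((LatticeDobrushin.threeSided W H).toDobrushin.bcBondConfig ω) (DiscreteDobrushin.startCorner hE) k =
      (![(x : ℤ), 0], 3)} with hV₃
  set V₂ : Set (BondConfig (Site 2)) := {ω : BondConfig (Site 2) | ∃ k < DiscreteDobrushin.exitTime hE ω,
    cornerOrbit ((LatticeDobrushin.threeSided W H).toDobrushin.bcBondConfig ω) (DiscreteDobrushin.startCorner hE) k =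
      (![(x : ℤ), 0], 2)} with hV₂
  -- the two integrands are indicators
  have h₃ : ∀ ω, dartPhaseSum (medialExploration (LatticeDobrushin.threeSided W H).toDobrushin ω) 1 (1 / 3)
      (![(x : ℤ), 0], faceAt ![(x : ℤ), 0] 3) = V₃.indicator (fun _ => (1 : ℂ)) ω :=
    fun ω => dartPhaseSum_q₃_N6 hE ω hx1 hxW
  have h₂ : ∀ ω, dartPhaseSum (medialExploration (LatticeDobrushin.threeSided W H).toDobrushin ω) 1 (1 / 3)
      (![(x : ℤ), 0], faceAt ![(x : ℤ), 0] 2) = V₂.indicator (fun _ => Complex.exp (Real.pi / 6 * Complex.I)) ω :=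
    fun ω => dartPhaseSum_q₂_N6 hE ω hx1 hxW
  have hV₃m : MeasurableSet V₃ :=
    measurableSet_of_indicator_N6 (measurable_dartPhaseSum_medialExploration hE 1 (1 / 3) _) one_ne_zero h₃
  have hV₂m : MeasurableSet V₂ :=
    measurableSet_of_indicator_N6 (measurable_dartPhaseSum_medialExploration hE 1 (1 / 3) _) (Complex.exp_ne_zero _) h₂
  refine ⟨?_, ?_, ?_, ?_⟩
  · -- (1) the east-going wall dart
    rw [cornerObs_eq_integral_dartPhaseSum, ← hP]
    rw [show (fun ω => dartPhaseSum (medialExploration (LatticeDobrushin.threeSided W H).toDobrushin ω) 1 (1 / 3)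
        (![(x : ℤ), 0], faceAt ![(x : ℤ), 0] 3)) = V₃.indicator (fun _ => (1 : ℂ)) from funext h₃,
      integral_indicator_const _ hV₃m, Complex.real_smul, mul_one]
  · -- (2) the south-going wall dart
    rw [cornerObs_eq_integral_dartPhaseSum, ← hP]
    rw [show (fun ω => dartPhaseSum (medialExploration (LatticeDobrushin.threeSided W H).toDobrushin ω) 1 (1 / 3)
        (![(x : ℤ), 0], faceAt ![(x : ℤ), 0] 2)) = V₂.indicator (fun _ => Complex.exp (Real.pi / 6 * Complex.I))
        from funext h₂,
      integral_indicator_const _ hV₂m, Complex.real_smul, mul_comm]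
  · -- (3) `V₂ ⊆ V₃`
    exact measureReal_mono (V₂_subset_V₃_N6 hE hx1 hxW) (measure_ne_top _ _)
  · -- (4) joined to `A` off the bottom row ⟹ the east-going wall dart is explored (a.e.)
    refine ENNReal.toReal_mono (measure_ne_top _ _) (measure_mono_ae ?_)
    filter_upwards [ae_subset_edgeSet (zdGraph 2) half] with ω hω h
    obtain ⟨a, haA, hconn⟩ := h
    exact threeSided_wallDart_of_joined W H hE ω x hx1 hxW ⟨a, haA, reachable_bc_of_openConnIn_N6 hω hconn⟩

end

end Summit.CriticalPhenomena.CardyFormulaZ2.Cruxes.EdgePrecompact.QkzStripBoundaryArm
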